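import Mathlib.Combinatorics.SetFamily.Compression.Down
import Mathlib.Combinatorics.Colex
import Mathlib.LinearAlgebra.Matrix.Determinant.Basic
import Mathlib.LinearAlgebra.Matrix.Block
import Mathlib.LinearAlgebra.Matrix.SchurComplement
import Mathlib.Data.Nat.Choose.Sum
import HarnessLib

/-!
# The shift-determinant theorem: the inclusion matrix between a down-compressed set family and the
# family itself is unimodular (row `F` of the master-family inequality, comb form — support file)

Support file (lead seat `prim-nh-lead-4575`, gen 110; `--supports stmt-CriticalPhenomena-4575`), first half of the
formalisation of prim-bnk-2 g21's hand proof of THEOREM F (`run/shared/lean/prim/prim-l12/prim-bnk-2/PROOF-F-inequality.md`,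
§4 "THEOREM S").  No definitions (compressions are Mathlib's `Finset.Down.compression`, iterated along a list by
`List.foldl`; matrices are written with `Matrix.of`), no `sorry`, standard axioms.

**THEOREM S (`SahiFComb.Shift.isUnit_det_incl_downs`).**  For every finite family `𝒢` of finite sets, every list `l` of
distinct coordinates and every bijection `e` between `𝒢` and the iterated down-compression `D_l 𝒢`, the integer matrix
`([e a ⊆ b])_{a b ∈ 𝒢}` has determinant `±1`.

Proof (the memo's 12-line induction): split off the first coordinate `c` of `l`.  The `c`-free part of `D_l 𝒢` is
`D_{l'}(𝒢⁰ ∪ 𝒢¹)` and the `c`-part (with `c` erased) is `D_{l'}(𝒢⁰ ∩ 𝒢¹)`, where `𝒢⁰` = members avoiding `c` and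
`𝒢¹` = members containing `c`, with `c` erased (`Finset.nonMemberSubfamily` / `memberSubfamily`).  After the column
operation `col(K+c) −= col(K)` for `K ∈ 𝒢⁰ ∩ 𝒢¹` (right multiplication by a unipotent matrix, determinant `1` by the
Weinstein–Aronszajn identity) and regrouping of the columns into `(𝒢⁰ ∪ 𝒢¹) ⊕ (𝒢⁰ ∩ 𝒢¹)`, the matrix is block lower
triangular with diagonal blocks of the same shape for the shorter list `l'`; the base case is the unitriangular matrix
`([a ⊆ b])_{a b ∈ 𝒢}` (determinant `1`, colex order).  The statement is used (companion file) to produce the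
Kleitman-type dominating bijection `σG ∖ G → G ∖ σ(D_l(G ∩ σG))` behind `K(A,B,G) ≥ 0`. [this work]
-/

namespace Summit.CriticalPhenomena.PercolationContinuityZ3.Theorems

namespace SahiFComb.Shift

open Finset FinsetFamily Matrix

variable {α : Type*} [DecidableEq α]

/-! ### 1. Iterated down-compression and the split along a coordinate -/

/-- The down-compression along `i ≠ c` commutes with taking the `c`-free part of a family. [this work] -/
theorem nonMemberSubfamily_compression {c i : α} (hic : i ≠ c) (𝒳 : Finset (Finset α)) :
    (𝓓 i 𝒳).nonMemberSubfamily c = 𝓓 i (𝒳.nonMemberSubfamily c) := by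
  ext s
  simp only [mem_nonMemberSubfamily, Down.mem_compression, mem_insert, mem_erase]
  constructor
  · rintro ⟨h | h, hc⟩
    · exact Or.inl ⟨⟨h.1, hc⟩, h.2, fun h' => hc h'.2⟩
    · exact Or.inr ⟨fun h' => h.1 h'.1, h.2, by rintro (rfl | h'); exact hic rfl; exact hc h'⟩
  · rintro (⟨⟨h1, hc⟩, h2, -⟩ | ⟨h1, h2, h3⟩)
    · exact ⟨Or.inl ⟨h1, h2⟩, hc⟩
    · have hc : c ∉ s := fun h => h3 (Or.inr h)
      exact ⟨Or.inr ⟨fun h => h1 ⟨h, hc⟩, h2⟩, hc⟩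

/-- The down-compression along `i ≠ c` commutes with taking the `c`-part (with `c` erased) of a family. [this work] -/
theorem memberSubfamily_compression {c i : α} (hic : i ≠ c) (𝒳 : Finset (Finset α)) :
    (𝓓 i 𝒳).memberSubfamily c = 𝓓 i (𝒳.memberSubfamily c) := by
  ext s
  simp only [mem_memberSubfamily, Down.mem_compression, mem_insert]
  have e1 : (insert c s).erase i = insert c (s.erase i) := erase_insert_of_ne hic.symm
  have e2 : insert i (insert c s) = insert c (insert i s) := Finset.insert_comm i c s
  rw [e1, e2]
  constructor
  · rintro ⟨h | h, hc⟩
    · exact Or.inl ⟨⟨h.1, hc⟩, h.2, fun h' => hc (mem_of_mem_erase h')⟩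
    · refine Or.inr ⟨fun h' => h.1 h'.1, h.2, ?_⟩
      rintro (rfl | h'); exact hic rfl; exact hc h'
  · rintro (⟨⟨h1, hc⟩, h2, -⟩ | ⟨h1, h2, h3⟩)
    · exact ⟨Or.inl ⟨h1, h2⟩, hc⟩
    · have hc : c ∉ s := fun h => h3 (Or.inr h)
      exact ⟨Or.inr ⟨fun h => h1 ⟨h, hc⟩, h2⟩, hc⟩

/-- After down-compressing along `c`, the `c`-free part is `𝒢⁰ ∪ 𝒢¹`. [this work] -/
theorem nonMemberSubfamily_compression_self (c : α) (𝒢 : Finset (Finset α)) :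
    (𝓓 c 𝒢).nonMemberSubfamily c = 𝒢.nonMemberSubfamily c ∪ 𝒢.memberSubfamily c := by
  ext s
  simp only [mem_nonMemberSubfamily, Down.mem_compression, mem_union, mem_memberSubfamily]
  constructor
  · rintro ⟨h | h, hc⟩
    · exact Or.inl ⟨h.1, hc⟩
    · exact Or.inr ⟨h.2, hc⟩
  · rintro (⟨h, hc⟩ | ⟨h, hc⟩)
    · exact ⟨Or.inl ⟨h, by rwa [erase_eq_of_notMem hc]⟩, hc⟩
    · by_cases hs : s ∈ 𝒢
      · exact ⟨Or.inl ⟨hs, by rwa [erase_eq_of_notMem hc]⟩, hc⟩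
      · exact ⟨Or.inr ⟨hs, h⟩, hc⟩

/-- After down-compressing along `c`, the `c`-part (with `c` erased) is `𝒢⁰ ∩ 𝒢¹`. [this work] -/
theorem memberSubfamily_compression_self (c : α) (𝒢 : Finset (Finset α)) :
    (𝓓 c 𝒢).memberSubfamily c = 𝒢.nonMemberSubfamily c ∩ 𝒢.memberSubfamily c := by
  ext s
  simp only [mem_memberSubfamily, Down.mem_compression, mem_inter, mem_nonMemberSubfamily]
  constructor
  · rintro ⟨⟨h1, h2⟩ | ⟨h1, h2⟩, hc⟩
    · rw [erase_insert hc] at h2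
      exact ⟨⟨h2, hc⟩, h1, hc⟩
    · rw [Finset.insert_idem] at h2
      exact absurd h2 h1
  · rintro ⟨⟨h1, hc⟩, h2, -⟩
    exact ⟨Or.inl ⟨h2, by rwa [erase_insert hc]⟩, hc⟩

/-- Iterated down-compression along a list avoiding `c` commutes with the `c`-free part. [this work] -/
theorem nonMemberSubfamily_downs {c : α} :
    ∀ (l : List α), c ∉ l → ∀ 𝒳 : Finset (Finset α),
      (l.foldl (fun 𝒴 i => 𝓓 i 𝒴) 𝒳).nonMemberSubfamily c = l.foldl (fun 𝒴 i => 𝓓 i 𝒴) (𝒳.nonMemberSubfamily c)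
  | [], _, 𝒳 => rfl
  | i :: l, h, 𝒳 => by
    have hic : i ≠ c := by rintro rfl; exact h List.mem_cons_self
    rw [List.foldl_cons, List.foldl_cons, nonMemberSubfamily_downs l (fun h' => h (List.mem_cons_of_mem _ h')),
      nonMemberSubfamily_compression hic]

/-- Iterated down-compression along a list avoiding `c` commutes with the `c`-part. [this work] -/
theorem memberSubfamily_downs {c : α} :
    ∀ (l : List α), c ∉ l → ∀ 𝒳 : Finset (Finset α),
      (l.foldl (fun 𝒴 i => 𝓓 i 𝒴) 𝒳).memberSubfamily c = l.foldl (fun 𝒴 i => 𝓓 i 𝒴) (𝒳.memberSubfamily c)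
  | [], _, 𝒳 => rfl
  | i :: l, h, 𝒳 => by
    have hic : i ≠ c := by rintro rfl; exact h List.mem_cons_self
    rw [List.foldl_cons, List.foldl_cons, memberSubfamily_downs l (fun h' => h (List.mem_cons_of_mem _ h')),
      memberSubfamily_compression hic]

/-- Iterated down-compression preserves the size of the family. [this work] -/
theorem card_downs : ∀ (l : List α) (𝒳 : Finset (Finset α)), #(l.foldl (fun 𝒴 i => 𝓓 i 𝒴) 𝒳) = #𝒳
  | [], 𝒳 => rfl
  | i :: l, 𝒳 => by rw [List.foldl_cons, card_downs l, Down.card_compression]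


/-! ### 2. Inclusion matrices and the unitriangular base case -/

/-- The inclusion (zeta) matrix between two set families: entry `1` at `(F, K)` iff `F ⊆ K`. [folklore] -/
def incl (𝒳 𝒴 : Finset (Finset α)) : Matrix 𝒳 𝒴 ℤ :=
  Matrix.of fun F K => if (F : Finset α) ⊆ (K : Finset α) then 1 else 0

/-- Entries of the inclusion matrix. [folklore] -/
@[simp] theorem incl_apply (𝒳 𝒴 : Finset (Finset α)) (F : 𝒳) (K : 𝒴) :
    incl 𝒳 𝒴 F K = if (F : Finset α) ⊆ (K : Finset α) then 1 else 0 := rfl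

/-- The self-inclusion matrix of a family is unitriangular (colex order), hence has determinant `1`. [folklore] -/
theorem det_incl_self [LinearOrder α] (𝒢 : Finset (Finset α)) : (incl 𝒢 𝒢).det = 1 := by
  let g : {t : Colex (Finset α) // ofColex t ∈ 𝒢} ≃ (𝒢 : Set (Finset α)) :=
    ofColex.subtypeEquiv (fun t => Iff.rfl)
  letI : DecidableEq {t : Colex (Finset α) // ofColex t ∈ 𝒢} := fun a b =>
    decidable_of_iff (ofColex a.1 = ofColex b.1) (by rw [ofColex.injective.eq_iff, Subtype.ext_iff])
  letI : Fintype {t : Colex (Finset α) // ofColex t ∈ 𝒢} := Fintype.ofEquiv _ g.symm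
  rw [← Matrix.det_submatrix_equiv_self g]
  have hT : ((incl 𝒢 𝒢).submatrix g g).BlockTriangular id := by
    intro i j hij
    simp only [submatrix_apply, incl_apply, id_eq] at hij ⊢
    rw [if_neg]
    intro hsub
    have hle : toColex (ofColex i.1) ≤ toColex (ofColex j.1) := Finset.Colex.toColex_le_toColex_of_subset hsub
    rw [toColex_ofColex, toColex_ofColex] at hle
    exact not_le.2 hij hle
  rw [Matrix.det_of_upperTriangular hT]
  simp [submatrix_apply, incl_apply]

/-! ### 3. THEOREM S -/

/-- Splitting a family along a coordinate `c`: `𝒳 ≃ 𝒳⁰ ⊕ 𝒳¹` with `inl F ↦ F` (members avoiding `c`) and `inr F ↦ insert c F`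
(members containing `c`, stored with `c` erased). [this work] -/
def sumEquiv (c : α) (𝒳 : Finset (Finset α)) : (𝒳.nonMemberSubfamily c) ⊕ (𝒳.memberSubfamily c) ≃ 𝒳 where
  toFun := fun x => match x with
    | Sum.inl F => ⟨F.1, (mem_nonMemberSubfamily.1 F.2).1⟩
    | Sum.inr F => ⟨insert c F.1, (mem_memberSubfamily.1 F.2).1⟩
  invFun := fun K => if h : c ∈ (K : Finset α) then Sum.inr ⟨(K : Finset α).erase c, by
        rw [mem_memberSubfamily, insert_erase h]; exact ⟨K.2, notMem_erase c _⟩⟩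
      else Sum.inl ⟨K.1, mem_nonMemberSubfamily.2 ⟨K.2, h⟩⟩
  left_inv := by
    rintro (F | F)
    · have hc : c ∉ (F : Finset α) := (mem_nonMemberSubfamily.1 F.2).2
      simp [hc]
    · have hc : c ∉ (F : Finset α) := (mem_memberSubfamily.1 F.2).2
      simp [hc, erase_insert hc]
  right_inv := by
    intro K
    by_cases h : c ∈ (K : Finset α)
    · simp [h, insert_erase h]
    · simp [h]

/-- `sumEquiv` on the `c`-free summand. [this work] -/
@[simp] theorem sumEquiv_inl (c : α) (𝒳 : Finset (Finset α)) (F : 𝒳.nonMemberSubfamily c) :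
    ((sumEquiv c 𝒳 (Sum.inl F) : 𝒳) : Finset α) = F := rfl

/-- `sumEquiv` on the `c`-summand. [this work] -/
@[simp] theorem sumEquiv_inr (c : α) (𝒳 : Finset (Finset α)) (F : 𝒳.memberSubfamily c) :
    ((sumEquiv c 𝒳 (Sum.inr F) : 𝒳) : Finset α) = insert c (F : Finset α) := rfl

/-- Regrouping two families: `(𝒜 ∪ ℬ) ⊕ (𝒜 ∩ ℬ) ≃ 𝒜 ⊕ ℬ` (`inl K ↦ inl K` if `K ∈ 𝒜` else `inr K`; `inr K ↦ inr K`). [this work] -/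
def regroup (𝒜 ℬ : Finset (Finset α)) : (↥(𝒜 ∪ ℬ)) ⊕ (↥(𝒜 ∩ ℬ)) ≃ 𝒜 ⊕ ℬ where
  toFun := fun x => match x with
    | Sum.inl K => if h : (K : Finset α) ∈ 𝒜 then Sum.inl ⟨K.1, h⟩
        else Sum.inr ⟨K.1, (mem_union.1 K.2).resolve_left h⟩
    | Sum.inr K => Sum.inr ⟨K.1, (mem_inter.1 K.2).2⟩
  invFun := fun x => match x with
    | Sum.inl K => Sum.inl ⟨K.1, mem_union_left _ K.2⟩
    | Sum.inr K => if h : (K : Finset α) ∈ 𝒜 then Sum.inr ⟨K.1, mem_inter.2 ⟨h, K.2⟩⟩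
        else Sum.inl ⟨K.1, mem_union_right _ K.2⟩
  left_inv := by
    rintro (K | K)
    · by_cases h : (K : Finset α) ∈ 𝒜
      · simp [h]
      · simp [h]
    · have h : (K : Finset α) ∈ 𝒜 := (mem_inter.1 K.2).1
      simp [h]
  right_inv := by
    rintro (K | K)
    · simp [K.2]
    · by_cases h : (K : Finset α) ∈ 𝒜
      · simp [h]
      · simp [h]

/-- **THEOREM S** (prim-bnk-2 g21, PROOF-F-inequality.md §4; lead-verified).  For every family `𝒢`, every list `l` of
distinct coordinates and every bijection `e : 𝒢 ≃ D_l 𝒢` onto the iterated down-compression, the square inclusion matrix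
`([e a ⊆ b])_{a,b ∈ 𝒢}` has a unit (i.e. `±1`) determinant. [this work] -/
theorem isUnit_det_incl_downs [LinearOrder α] :
    ∀ (l : List α), l.Nodup → ∀ (𝒢 : Finset (Finset α))
      (e : (𝒢 : Set (Finset α)) ≃ ↥(l.foldl (fun 𝒴 i => 𝓓 i 𝒴) 𝒢)),
      IsUnit ((incl (l.foldl (fun 𝒴 i => 𝓓 i 𝒴) 𝒢) 𝒢).submatrix e id).det
  | [], _, 𝒢, e => by
    -- `e` is a permutation of `𝒢`; the matrix is the row-permuted unitriangular matrix
    have h1 : ((incl 𝒢 𝒢).submatrix (e : ↥𝒢 → ↥𝒢) id).det = Equiv.Perm.sign e * (incl 𝒢 𝒢).det :=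
      Matrix.det_permute e (incl 𝒢 𝒢)
    change IsUnit ((incl 𝒢 𝒢).submatrix (e : ↥𝒢 → ↥𝒢) id).det
    rw [h1, det_incl_self, mul_one]
    exact Units.isUnit _
  | c :: l, hl, 𝒢, e₀₀ => by
    obtain ⟨hcl, hl'⟩ : c ∉ l ∧ l.Nodup := List.nodup_cons.1 hl
    suffices key : ∀ D : Finset (Finset α), D = (c :: l).foldl (fun 𝒴 i => 𝓓 i 𝒴) 𝒢 →
        ∀ e : (𝒢 : Set (Finset α)) ≃ ↥D, IsUnit ((incl D 𝒢).submatrix e id).det from key _ rfl e₀₀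
    intro D hD e
    set 𝒢₀ := 𝒢.nonMemberSubfamily c with h𝒢₀
    set 𝒢₁ := 𝒢.memberSubfamily c with h𝒢₁
    set U := 𝒢₀ ∪ 𝒢₁ with hU
    set I := 𝒢₀ ∩ 𝒢₁ with hI
    set R₀ : Finset (Finset α) := l.foldl (fun 𝒴 i => 𝓓 i 𝒴) U with hR₀
    set R₁ : Finset (Finset α) := l.foldl (fun 𝒴 i => 𝓓 i 𝒴) I with hR₁
    have hD' : D = l.foldl (fun 𝒴 i => 𝓓 i 𝒴) (𝓓 c 𝒢) := hD
    have hDR₀ : D.nonMemberSubfamily c = R₀ := by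
      rw [hD', nonMemberSubfamily_downs l hcl, nonMemberSubfamily_compression_self]
    have hDR₁ : D.memberSubfamily c = R₁ := by
      rw [hD', memberSubfamily_downs l hcl, memberSubfamily_compression_self]
    -- members of `U`, `I`, `R₀`, `R₁` avoid `c`
    have hU_c : ∀ K ∈ U, c ∉ K := fun K hK => (mem_union.1 hK).elim
      (fun h => (mem_nonMemberSubfamily.1 h).2) (fun h => (mem_memberSubfamily.1 h).2)
    have hI_c : ∀ K ∈ I, c ∉ K := fun K hK => hU_c K (mem_union_left _ (mem_inter.1 hK).1)
    have hR₀_c : ∀ F ∈ R₀, c ∉ F := fun F hF => (mem_nonMemberSubfamily.1 (hDR₀.symm ▸ hF)).2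
    have hR₁_c : ∀ F ∈ R₁, c ∉ F := fun F hF => (mem_memberSubfamily.1 (hDR₁.symm ▸ hF)).2
    -- induction hypotheses with some bijections (cardinalities agree)
    have hcU : Fintype.card ↥U = Fintype.card ↥R₀ := by simp only [Fintype.card_coe, hR₀, card_downs]
    have hcI : Fintype.card ↥I = Fintype.card ↥R₁ := by simp only [Fintype.card_coe, hR₁, card_downs]
    let e₀ : ↥U ≃ ↥R₀ := Fintype.equivOfCardEq hcU
    let e₁ : ↥I ≃ ↥R₁ := Fintype.equivOfCardEq hcI
    have ih₀ : IsUnit ((incl R₀ U).submatrix e₀ id).det := isUnit_det_incl_downs l hl' U e₀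
    have ih₁ : IsUnit ((incl R₁ I).submatrix e₁ id).det := isUnit_det_incl_downs l hl' I e₁
    -- the row map `U ⊕ I → D` and the column map `U ⊕ I → 𝒢`
    let ρ : ↥R₀ ⊕ ↥R₁ ≃ ↥D :=
      (Equiv.sumCongr (Equiv.subtypeEquivRight (fun F => by rw [hDR₀]))
        (Equiv.subtypeEquivRight (fun F => by rw [hDR₁]))).symm.trans (sumEquiv c D)
    let f : ↥U ⊕ ↥I ≃ ↥D := (Equiv.sumCongr e₀ e₁).trans ρ
    let g : ↥U ⊕ ↥I ≃ ↥𝒢 := (regroup 𝒢₀ 𝒢₁).trans (sumEquiv c 𝒢)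
    have hf_inl : ∀ u : ↥U, ((f (Sum.inl u) : ↥D) : Finset α) = (e₀ u : Finset α) := fun u => rfl
    have hf_inr : ∀ i : ↥I, ((f (Sum.inr i) : ↥D) : Finset α) = insert c (e₁ i : Finset α) := fun i => rfl
    have hg_inl : ∀ u : ↥U, ((g (Sum.inl u) : ↥𝒢) : Finset α) =
        if (u : Finset α) ∈ 𝒢₀ then (u : Finset α) else insert c (u : Finset α) := by
      intro u
      by_cases h : (u : Finset α) ∈ 𝒢₀
      · simp only [g, Equiv.trans_apply]; rw [if_pos h]; simp [regroup, h]; rfl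
      · simp only [g, Equiv.trans_apply]; rw [if_neg h]; simp [regroup, h]; rfl
    have hg_inr : ∀ i : ↥I, ((g (Sum.inr i) : ↥𝒢) : Finset α) = insert c (i : Finset α) := by
      intro i; simp only [g, Equiv.trans_apply]; simp [regroup]; rfl
    -- the column operation: `E = 1 - N`, `N K K' = [K' = insert c K, c ∉ K]`
    let N : Matrix ↥𝒢 ↥𝒢 ℤ := Matrix.of fun K K' =>
      if (K' : Finset α) = insert c (K : Finset α) ∧ c ∉ (K : Finset α) then 1 else 0
    let A : Matrix ↥𝒢 ↥I ℤ := Matrix.of fun K i => if (K : Finset α) = (i : Finset α) then 1 else 0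
    let B : Matrix ↥I ↥𝒢 ℤ := Matrix.of fun i K' => if (K' : Finset α) = insert c (i : Finset α) then 1 else 0
    have hN : N = A * B := by
      ext K K'
      simp only [N, A, B, Matrix.mul_apply, Matrix.of_apply]
      by_cases h : (K' : Finset α) = insert c (K : Finset α) ∧ c ∉ (K : Finset α)
      · rw [if_pos h]
        have hKI : (K : Finset α) ∈ I := by
          refine mem_inter.2 ⟨mem_nonMemberSubfamily.2 ⟨K.2, h.2⟩, mem_memberSubfamily.2 ⟨?_, h.2⟩⟩
          rw [← h.1]; exact K'.2
        rw [Finset.sum_eq_single ⟨K.1, hKI⟩]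
        · simp [h.1]
        · intro i _ hi
          have : (K : Finset α) ≠ (i : Finset α) := fun h' => hi (Subtype.ext h'.symm)
          simp [this]
        · intro h'; exact absurd (Finset.mem_univ _) h'
      · rw [if_neg h]
        symm
        refine Finset.sum_eq_zero fun i _ => ?_
        by_cases h1 : (K : Finset α) = (i : Finset α)
        · have h2 : ¬ (K' : Finset α) = insert c (i : Finset α) := by
            intro h2; apply h; rw [← h1] at h2; exact ⟨h2, h1 ▸ hI_c _ i.2⟩
          simp [h1, h2]
        · simp [h1]
    have hBA : B * A = 0 := by
      ext i i'
      simp only [Matrix.mul_apply, Matrix.of_apply, Matrix.zero_apply, A, B]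
      refine Finset.sum_eq_zero fun K _ => ?_
      by_cases h1 : (K : Finset α) = insert c (i : Finset α)
      · have h2 : ¬ insert c (i : Finset α) = (i' : Finset α) := by
          intro h2; apply hI_c _ i'.2; rw [← h2]; exact mem_insert_self _ _
        simp [h1, h2]
      · simp [h1]
    have hdetE : (1 - N : Matrix ↥𝒢 ↥𝒢 ℤ).det = 1 := by
      rw [hN, Matrix.det_one_sub_mul_comm, hBA, sub_zero, Matrix.det_one]
    -- the main matrix identity: rows `f`, columns `g` of `X * (1 - N)` form a block lower-triangular matrix
    set X : Matrix ↥D ↥𝒢 ℤ := incl D 𝒢 with hX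
    have hXN : ∀ (F : ↥D) (K' : ↥𝒢), (X * N) F K' =
        if c ∈ (K' : Finset α) ∧ (K' : Finset α).erase c ∈ 𝒢 then
          (if (F : Finset α) ⊆ (K' : Finset α).erase c then 1 else 0) else 0 := by
      intro F K'
      simp only [Matrix.mul_apply, hX, incl_apply, N, Matrix.of_apply]
      by_cases h : c ∈ (K' : Finset α) ∧ (K' : Finset α).erase c ∈ 𝒢
      · rw [if_pos h, Finset.sum_eq_single ⟨(K' : Finset α).erase c, h.2⟩]
        · simp [insert_erase h.1]
        · intro K _ hK
          have : ¬ ((K' : Finset α) = insert c (K : Finset α) ∧ c ∉ (K : Finset α)) := by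
            rintro ⟨h1, h2⟩; apply hK; apply Subtype.ext; simp [h1, erase_insert h2]
          simp [this]
        · intro h'; exact absurd (Finset.mem_univ _) h'
      · rw [if_neg h]
        refine Finset.sum_eq_zero fun K _ => ?_
        have : ¬ ((K' : Finset α) = insert c (K : Finset α) ∧ c ∉ (K : Finset α)) := by
          rintro ⟨h1, h2⟩; apply h; rw [h1, erase_insert h2]; exact ⟨mem_insert_self _ _, K.2⟩
        simp [this]
    have hXE : ∀ (F : ↥D) (K' : ↥𝒢), (X * (1 - N) : Matrix ↥D ↥𝒢 ℤ) F K' =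
        (if (F : Finset α) ⊆ (K' : Finset α) then 1 else 0) -
        (if c ∈ (K' : Finset α) ∧ (K' : Finset α).erase c ∈ 𝒢 then
          (if (F : Finset α) ⊆ (K' : Finset α).erase c then 1 else 0) else 0) := by
      intro F K'
      rw [Matrix.mul_sub, Matrix.mul_one, Matrix.sub_apply, hXN, hX, incl_apply]
    let Y : Matrix (↥U ⊕ ↥I) (↥U ⊕ ↥I) ℤ := (X * (1 - N)).submatrix f g
    have hY : Y = Matrix.fromBlocks ((incl R₀ U).submatrix e₀ id) 0
        (Matrix.of fun i u => Y (Sum.inr i) (Sum.inl u)) ((incl R₁ I).submatrix e₁ id) := by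
      ext x y
      rcases x with u | i <;> rcases y with u' | i'
      · -- upper left block
        simp only [Y, submatrix_apply, Matrix.fromBlocks_apply₁₁, incl_apply, id_eq]
        rw [hXE, hf_inl, hg_inl]
        by_cases h0 : (u' : Finset α) ∈ 𝒢₀
        · have hc' : c ∉ (u' : Finset α) := hU_c _ u'.2
          rw [if_pos h0, if_neg (show ¬ (c ∈ (u' : Finset α) ∧ (u' : Finset α).erase c ∈ 𝒢) from fun h => hc' h.1),
            sub_zero]
        · have hc' : c ∉ (u' : Finset α) := hU_c _ u'.2
          have hcu : c ∉ (e₀ u : Finset α) := hR₀_c _ (e₀ u).2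
          have hne : ¬ (c ∈ insert c (u' : Finset α) ∧ (insert c (u' : Finset α)).erase c ∈ 𝒢) := by
            rintro ⟨-, h2⟩; apply h0; rw [erase_insert hc'] at h2; exact mem_nonMemberSubfamily.2 ⟨h2, hc'⟩
          rw [if_neg h0, if_neg hne, sub_zero]
          by_cases hs : (e₀ u : Finset α) ⊆ (u' : Finset α)
          · rw [if_pos hs, if_pos (hs.trans (subset_insert c _))]
          · rw [if_neg hs, if_neg (show ¬ ((e₀ u : Finset α) ⊆ insert c (u' : Finset α)) from
              fun h' => hs ((subset_insert_iff_of_notMem hcu).1 h'))]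
      · -- upper right block: zero
        simp only [Y, submatrix_apply, Matrix.fromBlocks_apply₁₂, Matrix.zero_apply]
        rw [hXE, hf_inl, hg_inr]
        have hc' : c ∉ (i' : Finset α) := hI_c _ i'.2
        have hcu : c ∉ (e₀ u : Finset α) := hR₀_c _ (e₀ u).2
        have hyes : c ∈ insert c (i' : Finset α) ∧ (insert c (i' : Finset α)).erase c ∈ 𝒢 := by
          refine ⟨mem_insert_self _ _, ?_⟩; rw [erase_insert hc']
          exact (mem_nonMemberSubfamily.1 (mem_inter.1 i'.2).1).1
        rw [if_pos hyes, erase_insert hc']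
        by_cases hs : (e₀ u : Finset α) ⊆ (i' : Finset α)
        · rw [if_pos hs, if_pos (hs.trans (subset_insert c _)), sub_self]
        · rw [if_neg hs, if_neg (show ¬ ((e₀ u : Finset α) ⊆ insert c (i' : Finset α)) from
            fun h' => hs ((subset_insert_iff_of_notMem hcu).1 h')), sub_zero]
      · -- lower left block: by definition
        simp only [Matrix.fromBlocks_apply₂₁, Matrix.of_apply]
      · -- lower right block
        simp only [Y, submatrix_apply, Matrix.fromBlocks_apply₂₂, incl_apply, id_eq]
        rw [hXE, hf_inr, hg_inr]
        have hc' : c ∉ (i' : Finset α) := hI_c _ i'.2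
        have hci : c ∉ (e₁ i : Finset α) := hR₁_c _ (e₁ i).2
        have hyes : c ∈ insert c (i' : Finset α) ∧ (insert c (i' : Finset α)).erase c ∈ 𝒢 := by
          refine ⟨mem_insert_self _ _, ?_⟩; rw [erase_insert hc']
          exact (mem_nonMemberSubfamily.1 (mem_inter.1 i'.2).1).1
        rw [if_pos hyes, erase_insert hc']
        have hno : ¬ insert c (e₁ i : Finset α) ⊆ (i' : Finset α) := fun h => hc' (h (mem_insert_self _ _))
        rw [if_neg hno, sub_zero]
        by_cases hs : (e₁ i : Finset α) ⊆ (i' : Finset α)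
        · rw [if_pos hs, if_pos (insert_subset_insert c hs)]
        · rw [if_neg hs, if_neg (show ¬ (insert c (e₁ i : Finset α) ⊆ insert c (i' : Finset α)) from
            fun h' => hs ((subset_insert_iff_of_notMem hci).1 ((subset_insert c _).trans h')))]
    have hdetY : IsUnit Y.det := by
      rw [hY, Matrix.det_fromBlocks_zero₁₂]
      exact ih₀.mul ih₁
    -- relate `Y` to the matrix of the statement
    have hrel : Y = (((X.submatrix e id) * (1 - N)).submatrix g g).submatrix (f.trans (e.symm.trans g.symm)) id := by
      ext x y
      simp only [Y, submatrix_apply, Matrix.mul_apply, id_eq, Equiv.trans_apply, Equiv.apply_symm_apply]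
    rw [hrel, Matrix.det_permute, Matrix.det_submatrix_equiv_self, Matrix.det_mul, hdetE, mul_one] at hdetY
    exact (IsUnit.mul_iff.1 hdetY).2

end SahiFComb.Shift

end Summit.CriticalPhenomena.PercolationContinuityZ3.Theorems
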